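import Summits.HodgeConjecture.HodgeConjecture.Theorems.AnchorTransportVariationalHodgeReductions
import Literature.AlgebraicGeometry.HodgeTheory.MotivatedClassesDeformationInputs
import Literature.AlgebraicGeometry.HodgeTheory.QuasiProjectiveOfAffine
import Literature.AlgebraicGeometry.Motives.KunnethSections
import Literature.AlgebraicGeometry.Motives.VarietiesProperProofs
import Mathlib.AlgebraicGeometry.ZariskisMainTheorem

/-!
# Route AnchorTransport — `VariationalHodge` (stmt-HodgeConjecture-1076): quasi-projective total spaces

The crux `AnchorTransport.VariationalHodge` quantifies over smooth PROPER families `f : 𝒳 ⟶ S` with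
smooth projective fibres (`Motives.IsSmoothProjectiveFamily f n`), whereas Grothendieck's variational
Hodge conjecture (Charles–Schnell Conj. 11.3.1) and every engine of the tree (`Andre1996_deformation`,
`deligne_globalInvariantCycles`, `charlesSchnell_algebraicityLocus_iUnion_closed`, …) are about
smooth PROJECTIVE morphisms — `f` a closed `S`-immersion `𝒳 ↪ ℙᴺ × S` followed by the projection.
This file proves that the whole difference is **quasi-projectivity of the total space `𝒳`**, the
hypothesis (`IsQuasiProjectiveOver 𝒳`) that the crux lines already carry:

* `exists_isClosedImmersion_of_isQuasiProjectiveOver` — **a proper `S`-scheme whose total space is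
  quasi-projective over `ℂ` is projective over `S` in Hartshorne's sense**: for `j : 𝒳 ↪ P` open,
  `κ : P ↪ ℙᴺ` closed and `f` proper, `(κ ∘ j, f) : 𝒳 ⟶ ℙᴺ × S` is a proper monomorphism, i.e. a
  closed immersion (Stacks 04XV, Mathlib `IsClosedImmersion.iff_isProper_and_mono`).
* `isQuasiProjectiveOver_familyPullback` — quasi-projectivity of the total space is stable under
  restriction of the family to an open of the base.
* `variationalHodge_quasiProjective_of_projective`, `variationalHodge_projective_of_quasiProjective`
  — **the variational Hodge statement for projective smooth families (over smooth irreducible affine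
  bases) is EQUIVALENT to the crux as filed restricted to quasi-projective total spaces (over all
  smooth irreducible bases)**; `variationalHodge_quasiProjective_of_variationalHodge` — the crux as
  filed implies both.
* `variationalHodge_quasiProjective_of_standardConjectureB` — hence the Lefschetz standard conjecture
  `B` implies the crux for quasi-projective total spaces (André 1996, granted the named facts of
  `variationalHodge_projective_of_standardConjectureB`).
* `variationalHodge_of_projective_of_isQuasiProjectiveOver` — the crux AS FILED follows from the
  projective statement granted only that total spaces of smooth proper families with projective
  fibres over smooth irreducible affine bases are quasi-projective (false in general — Atiyah-flop
  families — which is the residual mis-statement, now a single named predicate).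
-/

noncomputable section

-- every declaration of this problem lives in `Summit.HodgeConjecture.HodgeConjecture.…` (summit = sub-problem)
set_option linter.dupNamespace false

open CategoryTheory AlgebraicGeometry TopologicalSpace MonoidalCategory
open Literature.AlgebraicGeometry.Motives Literature.AlgebraicGeometry.HodgeTheory
open Summit.HodgeConjecture.HodgeConjecture.Theses.AnchorTransport

namespace Summit.HodgeConjecture.HodgeConjecture.Theorems

/-! ### Proper morphisms with quasi-projective source are projective -/

/-- **A proper family with quasi-projective total space is projective in Hartshorne's sense.** If
`f : 𝒳 ⟶ S` is a proper morphism of `ℂ`-schemes and `𝒳` is quasi-projective over `ℂ` — an open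
immersion `j : 𝒳 ↪ P` into a projective `P`, `κ : P ↪ ℙᴺ` a closed immersion — then
`ι = (κ ∘ j, f) : 𝒳 ⟶ ℙᴺ × S` is a closed immersion with `pr_S ∘ ι = f`: `ι` is proper because
`pr_S ∘ ι = f` is proper and `pr_S` (a base change of `ℙᴺ → Spec ℂ`) is separated, and a
monomorphism because `pr_{ℙᴺ} ∘ ι = κ ∘ j` is one; proper monomorphisms are exactly the closed
immersions (Stacks 04XV; Hartshorne II Cor. 4.8 (e)). [cite: StacksProject, Tag 04XV]
[cite: Hartshorne1977, Ch. II Cor. 4.8 (e) and §4 p. 103 (projective morphisms)] -/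
theorem exists_isClosedImmersion_of_isQuasiProjectiveOver {𝒳 S : SchemeOver ℂ} (f : 𝒳 ⟶ S)
    [IsProper f.left] (h𝒳 : IsQuasiProjectiveOver 𝒳) :
    ∃ (N : ℕ) (ι : 𝒳 ⟶ projectiveSpace N ℂ ⊗ S), IsClosedImmersion ι.left ∧
      ι ≫ CartesianMonoidalCategory.snd (projectiveSpace N ℂ) S = f := by
  obtain ⟨P, j, ⟨N, κ, hκ⟩, hj⟩ := h𝒳
  haveI := hκ
  haveI := hj
  refine ⟨N, CartesianMonoidalCategory.lift (j ≫ κ) f, ?_, CartesianMonoidalCategory.lift_snd _ _⟩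
  -- the projection `ℙᴺ × S ⟶ S` is proper (base change of `ℙᴺ ⟶ Spec ℂ`), in particular separated
  haveI : IsProper (CartesianMonoidalCategory.snd (projectiveSpace N ℂ) S).left :=
    MorphismProperty.of_isPullback (P := @IsProper) (isPullback_fst_snd (projectiveSpace N ℂ) S)
      (isProper_projectiveSpace N ℂ)
  -- `ι` is proper: `ι ≫ pr_S = f`
  haveI : IsProper ((CartesianMonoidalCategory.lift (j ≫ κ) f).left ≫
      (CartesianMonoidalCategory.snd (projectiveSpace N ℂ) S).left) := by
    rw [← Over.comp_left, CartesianMonoidalCategory.lift_snd]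
    infer_instance
  haveI : IsProper (CartesianMonoidalCategory.lift (j ≫ κ) f).left :=
    IsProper.of_comp _ (CartesianMonoidalCategory.snd (projectiveSpace N ℂ) S).left
  -- `ι` is a monomorphism: `ι ≫ pr_{ℙᴺ} = j ≫ κ`
  haveI : Mono ((CartesianMonoidalCategory.lift (j ≫ κ) f).left ≫
      (CartesianMonoidalCategory.fst (projectiveSpace N ℂ) S).left) := by
    rw [← Over.comp_left, CartesianMonoidalCategory.lift_fst, Over.comp_left]
    infer_instance
  haveI : Mono (CartesianMonoidalCategory.lift (j ≫ κ) f).left :=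
    mono_of_mono _ (CartesianMonoidalCategory.fst (projectiveSpace N ℂ) S).left
  exact (IsClosedImmersion.iff_isProper_and_mono _).2 ⟨inferInstance, inferInstance⟩

/-- For a smooth projective family in the tree's sense (smooth + PROPER + projective fibres) with
quasi-projective total space, `f` is projective in Hartshorne's sense
(`exists_isClosedImmersion_of_isQuasiProjectiveOver`). [cite: StacksProject, Tag 04XV] -/
theorem exists_isClosedImmersion_of_isSmoothProjectiveFamily {n : ℕ}
    {𝒳 S : SchemeOver ℂ} {f : 𝒳 ⟶ S} (hf : IsSmoothProjectiveFamily f n)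
    (h𝒳 : IsQuasiProjectiveOver 𝒳) :
    ∃ (N : ℕ) (ι : 𝒳 ⟶ projectiveSpace N ℂ ⊗ S), IsClosedImmersion ι.left ∧
      ι ≫ CartesianMonoidalCategory.snd (projectiveSpace N ℂ) S = f := by
  haveI := hf.isProper
  exact exists_isClosedImmersion_of_isQuasiProjectiveOver f h𝒳

/-- Conversely, over a smooth AFFINE base a family that is projective in Hartshorne's sense has
quasi-projective total space: `𝒳 ↪ ℙᴺ × S` closed and `ℙᴺ × S` quasi-projective, `S` being affine
of finite type (`IsQuasiProjectiveOver.of_isAffine`, `…of_isClosedImmersion_projectiveSpace_tensor`).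
[cite: Hartshorne1977, Ch. II §4 p. 103 and Ex. 4.9] -/
theorem isQuasiProjectiveOver_of_isClosedImmersion_of_isAffine {𝒳 S : SchemeOver ℂ} {f : 𝒳 ⟶ S}
    [IsAffine S.left] [AlgebraicGeometry.Smooth S.hom]
    (hι : ∃ (N : ℕ) (ι : 𝒳 ⟶ projectiveSpace N ℂ ⊗ S), IsClosedImmersion ι.left ∧
      ι ≫ CartesianMonoidalCategory.snd (projectiveSpace N ℂ) S = f) :
    IsQuasiProjectiveOver 𝒳 := by
  obtain ⟨N, ι, hι, -⟩ := hι
  haveI := hι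
  haveI : LocallyOfFiniteType S.hom := inferInstance
  exact IsQuasiProjectiveOver.of_isClosedImmersion_projectiveSpace_tensor ι
    (IsQuasiProjectiveOver.of_isAffine S)

/-- **Quasi-projectivity of the total space is stable under restriction to an open of the base**:
for `g : S' ⟶ S` an open immersion, `𝒳 ×_S S' ⟶ 𝒳` is an open immersion, and an open subscheme of a
quasi-projective scheme is quasi-projective. [cite: Hartshorne1977, Ch. II §4 p. 103] -/
theorem isQuasiProjectiveOver_familyPullback {𝒳 S S' : SchemeOver ℂ} (f : 𝒳 ⟶ S) (g : S' ⟶ S)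
    (hg : IsOpenImmersion g.left) (h𝒳 : IsQuasiProjectiveOver 𝒳) :
    IsQuasiProjectiveOver (familyPullback f g) := by
  obtain ⟨P, j, hP, hj⟩ := h𝒳
  haveI : IsOpenImmersion (familyPullback.fst f g).left :=
    MorphismProperty.of_isPullback (P := @IsOpenImmersion)
      ((familyPullback.isPullback f g).map (Over.forget _)).flip hg
  haveI := hj
  refine ⟨P, familyPullback.fst f g ≫ j, hP, ?_⟩
  rw [Over.comp_left]
  infer_instance

/-! ### `V′` (projective families) ⟺ the crux restricted to quasi-projective total spaces -/

/-- **The crux for quasi-projective total spaces follows from the variational Hodge statement for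
projective families over smooth irreducible affine bases.** Reduce to affine bases with the
`Q`-stable reduction (`variationalHodge_of_affine_of_stable`, `Q 𝒳 := IsQuasiProjectiveOver 𝒳`,
stable by `isQuasiProjectiveOver_familyPullback`); there the proper family with quasi-projective total
space is projective (`exists_isClosedImmersion_of_isQuasiProjectiveOver`). [folklore] -/
theorem variationalHodge_quasiProjective_of_projective
    (h : ∀ ⦃n : ℕ⦄ ⦃𝒳 S : SchemeOver ℂ⦄ (f : 𝒳 ⟶ S), IsSmoothProjectiveFamily f n →
      (∃ (N : ℕ) (ι : 𝒳 ⟶ projectiveSpace N ℂ ⊗ S), IsClosedImmersion ι.left ∧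
        ι ≫ CartesianMonoidalCategory.snd (projectiveSpace N ℂ) S = f) →
      IrreducibleSpace S.left → IsAffine S.left → AlgebraicGeometry.Smooth S.hom →
      ∀ (p : ℕ) (A : complexBetti 𝒳 (2 * p)),
      (∀ s : ComplexPoints S, IsRationalClass (complexBetti.map (fiberι f s) (2 * p) A) ∧
        IsOfHodgeType n (fiberOver f s) (2 * p) p p (complexBetti.map (fiberι f s) (2 * p) A)) →
      (∃ s₀ : ComplexPoints S,
        complexBetti.map (fiberι f s₀) (2 * p) A ∈ algebraicClasses (fiberOver f s₀) p) →
      ∀ s : ComplexPoints S,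
        complexBetti.map (fiberι f s) (2 * p) A ∈ algebraicClasses (fiberOver f s) p)
    ⦃n : ℕ⦄ ⦃𝒳 S : SchemeOver ℂ⦄ (f : 𝒳 ⟶ S) (hf : IsSmoothProjectiveFamily f n)
    (h𝒳 : IsQuasiProjectiveOver 𝒳)
    (hirr : IrreducibleSpace S.left) (hsm : AlgebraicGeometry.Smooth S.hom) (p : ℕ)
    (A : complexBetti 𝒳 (2 * p))
    (hA : ∀ s : ComplexPoints S, IsRationalClass (complexBetti.map (fiberι f s) (2 * p) A) ∧
      IsOfHodgeType n (fiberOver f s) (2 * p) p p (complexBetti.map (fiberι f s) (2 * p) A))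
    (hs₀ : ∃ s₀ : ComplexPoints S,
      complexBetti.map (fiberι f s₀) (2 * p) A ∈ algebraicClasses (fiberOver f s₀) p)
    (s : ComplexPoints S) :
    complexBetti.map (fiberι f s) (2 * p) A ∈ algebraicClasses (fiberOver f s) p :=
  variationalHodge_of_affine_of_stable (fun 𝒳 _ _ => IsQuasiProjectiveOver 𝒳)
    (fun _ _ _ f g hg hq => isQuasiProjectiveOver_familyPullback f g hg hq)
    (fun _ _ _ f hf hq hirr haff hsm p A hA hs₀ s =>
      h f hf (exists_isClosedImmersion_of_isSmoothProjectiveFamily hf hq) hirr haff hsm p A hA hs₀ s)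
    f hf h𝒳 hirr hsm p A hA hs₀ s

/-- **Conversely, the variational Hodge statement for projective families (over all smooth
irreducible bases) follows from the crux for quasi-projective total spaces over smooth irreducible
AFFINE bases**: reduce the projective statement to affine bases
(`variationalHodge_projective_of_affine`), where the total space of a projective family is
quasi-projective (`isQuasiProjectiveOver_of_isClosedImmersion_of_isAffine`). [folklore] -/
theorem variationalHodge_projective_of_quasiProjective
    (h : ∀ ⦃n : ℕ⦄ ⦃𝒳 S : SchemeOver ℂ⦄ (f : 𝒳 ⟶ S), IsSmoothProjectiveFamily f n →
      IsQuasiProjectiveOver 𝒳 →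
      IrreducibleSpace S.left → IsAffine S.left → AlgebraicGeometry.Smooth S.hom →
      ∀ (p : ℕ) (A : complexBetti 𝒳 (2 * p)),
      (∀ s : ComplexPoints S, IsRationalClass (complexBetti.map (fiberι f s) (2 * p) A) ∧
        IsOfHodgeType n (fiberOver f s) (2 * p) p p (complexBetti.map (fiberι f s) (2 * p) A)) →
      (∃ s₀ : ComplexPoints S,
        complexBetti.map (fiberι f s₀) (2 * p) A ∈ algebraicClasses (fiberOver f s₀) p) →
      ∀ s : ComplexPoints S,
        complexBetti.map (fiberι f s) (2 * p) A ∈ algebraicClasses (fiberOver f s) p)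
    ⦃n : ℕ⦄ ⦃𝒳 S : SchemeOver ℂ⦄ (f : 𝒳 ⟶ S) (hf : IsSmoothProjectiveFamily f n)
    (hι : ∃ (N : ℕ) (ι : 𝒳 ⟶ projectiveSpace N ℂ ⊗ S), IsClosedImmersion ι.left ∧
      ι ≫ CartesianMonoidalCategory.snd (projectiveSpace N ℂ) S = f)
    (hirr : IrreducibleSpace S.left) (hsm : AlgebraicGeometry.Smooth S.hom) (p : ℕ)
    (A : complexBetti 𝒳 (2 * p))
    (hA : ∀ s : ComplexPoints S, IsRationalClass (complexBetti.map (fiberι f s) (2 * p) A) ∧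
      IsOfHodgeType n (fiberOver f s) (2 * p) p p (complexBetti.map (fiberι f s) (2 * p) A))
    (hs₀ : ∃ s₀ : ComplexPoints S,
      complexBetti.map (fiberι f s₀) (2 * p) A ∈ algebraicClasses (fiberOver f s₀) p)
    (s : ComplexPoints S) :
    complexBetti.map (fiberι f s) (2 * p) A ∈ algebraicClasses (fiberOver f s) p :=
  variationalHodge_projective_of_affine
    (fun _ _ _ f hf hι hirr haff hsm p A hA hs₀ s => by
      haveI := haff
      haveI := hsm
      exact h f hf (isQuasiProjectiveOver_of_isClosedImmersion_of_isAffine hι) hirr haff hsm p A hA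
        hs₀ s)
    f hf hι hirr hsm p A hA hs₀ s

/-- **The crux as filed implies its restriction to quasi-projective total spaces** (drop the
hypothesis), hence — with `variationalHodge_projective_of_quasiProjective` — the variational Hodge
statement for projective families. [folklore] -/
theorem variationalHodge_quasiProjective_of_variationalHodge (hV : VariationalHodge)
    ⦃n : ℕ⦄ ⦃𝒳 S : SchemeOver ℂ⦄ (f : 𝒳 ⟶ S) (hf : IsSmoothProjectiveFamily f n)
    (_h𝒳 : IsQuasiProjectiveOver 𝒳)
    (hirr : IrreducibleSpace S.left) (hsm : AlgebraicGeometry.Smooth S.hom) (p : ℕ)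
    (A : complexBetti 𝒳 (2 * p))
    (hA : ∀ s : ComplexPoints S, IsRationalClass (complexBetti.map (fiberι f s) (2 * p) A) ∧
      IsOfHodgeType n (fiberOver f s) (2 * p) p p (complexBetti.map (fiberι f s) (2 * p) A))
    (hs₀ : ∃ s₀ : ComplexPoints S,
      complexBetti.map (fiberι f s₀) (2 * p) A ∈ algebraicClasses (fiberOver f s₀) p)
    (s : ComplexPoints S) :
    complexBetti.map (fiberι f s) (2 * p) A ∈ algebraicClasses (fiberOver f s) p :=
  hV f hf hirr hsm p A hA hs₀ s

/-- **The Lefschetz standard conjecture `B` implies the crux for quasi-projective total spaces**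
(over every smooth irreducible base), granted the named facts `Andre1996_deformation`,
`Andre1996_motivatedClasses_le_algebraicClasses_of_standardConjectureB` and
`nonempty_hardLefschetzNFold` (Charles–Schnell, remark after Thm. 11.3.8, via André 1996 Thm. 0.5):
`variationalHodge_projective_of_standardConjectureB` fed to
`variationalHodge_quasiProjective_of_projective`. For the crux as filed the same script stops at the
families whose total space is not quasi-projective. [cite: CharlesSchnell2014Notes, remark after Thm. 11.3.8] -/
theorem variationalHodge_quasiProjective_of_standardConjectureB
    (hB : ∀ (d : ℕ) (Z : SchemeOver ℂ) (η : complexBetti Z 2), IsSmoothProjective d Z →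
      StandardConjectureBStar d Z η)
    (hBA : Andre1996_motivatedClasses_le_algebraicClasses_of_standardConjectureB)
    (hD : Andre1996_deformation) (hHL : ∀ (m : ℕ) (Y : SchemeOver ℂ), nonempty_hardLefschetzNFold m Y)
    ⦃n : ℕ⦄ ⦃𝒳 S : SchemeOver ℂ⦄ (f : 𝒳 ⟶ S) (hf : IsSmoothProjectiveFamily f n)
    (h𝒳 : IsQuasiProjectiveOver 𝒳)
    (hirr : IrreducibleSpace S.left) (hsm : AlgebraicGeometry.Smooth S.hom) (p : ℕ)
    (A : complexBetti 𝒳 (2 * p))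
    (hA : ∀ s : ComplexPoints S, IsRationalClass (complexBetti.map (fiberι f s) (2 * p) A) ∧
      IsOfHodgeType n (fiberOver f s) (2 * p) p p (complexBetti.map (fiberι f s) (2 * p) A))
    (hs₀ : ∃ s₀ : ComplexPoints S,
      complexBetti.map (fiberι f s₀) (2 * p) A ∈ algebraicClasses (fiberOver f s₀) p)
    (s : ComplexPoints S) :
    complexBetti.map (fiberι f s) (2 * p) A ∈ algebraicClasses (fiberOver f s) p :=
  variationalHodge_quasiProjective_of_projective
    (fun _ _ _ f hf hι hirr _ hsm p A hA hs₀ s =>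
      variationalHodge_projective_of_standardConjectureB hB hBA hD hHL f hf hι hirr hsm p A hA hs₀ s)
    f hf h𝒳 hirr hsm p A hA hs₀ s

/-- **The crux AS FILED from the projective statement, granted quasi-projectivity of total spaces.**
If every smooth proper family with smooth projective fibres over a smooth irreducible AFFINE base had
quasi-projective total space (hypothesis `hqp` — NOT a theorem: the mixed small resolution of a
two-nodal quartic pencil, Atiyah 1958, is a smooth proper family of K3 surfaces over a smooth affine
curve whose total space is not quasi-projective), the variational Hodge statement for projective
families over smooth irreducible affine bases would give the crux (`variationalHodge_of_affine` +
`variationalHodge_quasiProjective_of_projective`). This is the exact residual difference between the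
decl and the printed conjecture, as ONE existing predicate on the total space. [folklore] -/
theorem variationalHodge_of_projective_of_isQuasiProjectiveOver
    (hqp : ∀ ⦃n : ℕ⦄ ⦃𝒳 S : SchemeOver ℂ⦄ (f : 𝒳 ⟶ S), IsSmoothProjectiveFamily f n →
      IrreducibleSpace S.left → IsAffine S.left → AlgebraicGeometry.Smooth S.hom →
      IsQuasiProjectiveOver 𝒳)
    (h : ∀ ⦃n : ℕ⦄ ⦃𝒳 S : SchemeOver ℂ⦄ (f : 𝒳 ⟶ S), IsSmoothProjectiveFamily f n →
      (∃ (N : ℕ) (ι : 𝒳 ⟶ projectiveSpace N ℂ ⊗ S), IsClosedImmersion ι.left ∧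
        ι ≫ CartesianMonoidalCategory.snd (projectiveSpace N ℂ) S = f) →
      IrreducibleSpace S.left → IsAffine S.left → AlgebraicGeometry.Smooth S.hom →
      ∀ (p : ℕ) (A : complexBetti 𝒳 (2 * p)),
      (∀ s : ComplexPoints S, IsRationalClass (complexBetti.map (fiberι f s) (2 * p) A) ∧
        IsOfHodgeType n (fiberOver f s) (2 * p) p p (complexBetti.map (fiberι f s) (2 * p) A)) →
      (∃ s₀ : ComplexPoints S,
        complexBetti.map (fiberι f s₀) (2 * p) A ∈ algebraicClasses (fiberOver f s₀) p) →
      ∀ s : ComplexPoints S,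
        complexBetti.map (fiberι f s) (2 * p) A ∈ algebraicClasses (fiberOver f s) p) :
    VariationalHodge :=
  variationalHodge_of_affine fun _ _ _ f hf hirr haff hsm p A hA hs₀ s =>
    variationalHodge_quasiProjective_of_projective h f hf (hqp f hf hirr haff hsm) hirr hsm p A hA
      hs₀ s

end Summit.HodgeConjecture.HodgeConjecture.Theorems

end
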